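import Summits.QuantumFields.YangMills.Theorems.BalabanUVNodesN16Eq42StencilFirstMoment
import Summits.QuantumFields.YangMills.Theorems.BalabanUVNodesN16Eq42StencilLipschitz
import Literature.MathematicalPhysics.QuantumFieldTheory.Balaban1983to89.B7Prop9General
import HarnessLib

/-!
# YM-DAG node N16 (NE3), the located averaging pin (42) ↔ (0.4) — part 8: THE q-DEPENDENT FIRST-MOMENT 1-FORM IS A GAUGE.
# Lattice Poincaré lemma for `asum` 1-forms in the axial gauge (closed ⇒ exact; ‖θ − dλ_q‖ ≤ |x − q|₁ · sup‖curl θ‖), the curl of the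
# first-moment form `ω_c(y,κ) = Σ_m c_m • A(∂p)_y(m κ)` is `Σ_m c_m •`[first differences of the flux], hence `ω_c = dλ_q` EXACTLY at constant
# curvature and `ω_c = dλ_q + O(|x − q|₁ · δ · Σ_m|c_m|) = dλ_q + O(d²L³δ)` on every block for δ-Lipschitz flux; with part 7:
# corner (42) − offset∕centred (0.4) stencil = the pure gauge `dλ_q` + `O(L³δ)` — the last LOCATED sentence of `W3-PIN-ANATOMY.md` v2, typed

Cell `pub-ymgap`, width seat `pub-ymgap-dag-n16-w3` (director-ym №197 ∕ HUMAN RULING D-0149), generation 5; part 8 of the W1b sequel (parts 1–7: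
p593546 · p594757 · p595773 · p596738 · p597832 · p599568 · p600641).  `--kind proof --supports stmt-QuantumFields-20544 --as helper` (K3⁷; count-neutral;
0 def).  `bears_on: R4∕N16`.

THE POINT.  Parts 6–7 showed that the block-CENTRING part of the pin (42) ↔ (0.4) is, at first order, the FIRST-MOMENT 1-form
`ω(y,κ) = Σ_m c_m • F_{mκ}(y)` (`F_{mκ}(y) = A(∂p)_y(plaqWord m κ)`, `c_m = L(L−1)∕2` for corner-vs-centred, `c_m = L·s_m` for corner-vs-offset-`s`):
EXACTLY a gradient at constant curvature (part 6 `stencil_shift_is_gradient`), base-point value `+ O(L³δ)` on Lipschitz flux (part 7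
`norm_corner_sub_stencil_sub_le`).  What part 7's header still lists as «NOT typed» is the cohomological sentence for the q-DEPENDENT form: its lattice
curl is a first DIFFERENCE of `F`, so it is a pure gauge up to `O(L³δ)`.  This file types it, definition-free, over the tree's `asum` calculus:
 * §1 (bookkeeping) `asum_seg_succ_int`; the three-piece split of the tree potential `λ_q(x) := asum θ q (treeWord (x − q))` along
   `B7Prop9General.treeWord_split` (cited, not restated); ★ `sub_axial_eq_loop`: the axial-gauge DEFECT `θ(q+v, κ) − (λ_q(q+v+e_κ) − λ_q(q+v))` IS the
   circulation of `θ` around the UNIT-bond (42)-loop `Γ_{c,·} ∪ −Γ_c` (`gammaWord 1 κ (loPart κ v) ++ seg κ (−1)`, tree `asum_loop_eq` at `L = 1`) based at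
   `q + hiPart κ v + v_κ e_κ`;
 * §2 THE LATTICE POINCARÉ LEMMA: ★ `eq_axial_of_closed` — a 1-form whose plaquette circulations in the planes `(·, κ)` vanish equals `dλ_q` on every
   `κ`-bond (part 6's `asum_loop_const_flux` at `L = 1`, `f = 0`: ℤᵈ has no first cohomology, with the explicit axial potential); ★★ `norm_sub_axial_le` —
   if those circulations are `≤ η` within `|·|₁`-distance `3|v|₁ + 1` of `q`, then `‖θ(q+v,κ) − dλ_q(q+v,κ)‖ ≤ |v|₁·η` (part 7's `norm_loop_sub_le` at
   `L = 1`, `f = 0`); `norm_sub_le_of_unit_steps` (a site function with `δ`-bounded unit differences moves by `≤ δ·|w|₁` along `Γ_{x,x+w}`);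
 * §3 THE CURL OF THE MOMENT FORM `ω_c(y,κ) = Σ_m c_m • F_y(m κ)` of ANY plane-indexed family of site functions `F` (the flux
   `F_y(m κ) = A(∂p)_y(m κ)` in §5; its coarse samples in part 9): `curl_moment_eq` (by `asum_plaqWord`:
   `ω_c(∂p)_y(μ ν) = Σ_m c_m • [(F_{y+e_μ}(mν) − F_y(mν)) − (F_{y+e_ν}(mμ) − F_y(mμ))]`), `curl_moment_of_const` (`= 0`), `norm_curl_moment_le`
   (`≤ 2δ·Σ_m|c_m|` when `F` moves by `≤ δ` under unit steps);
 * §4 ★ `moment_eq_axial_of_const` (constant data: `ω_c = dλ_q` EXACTLY — part 6's conclusion re-derived cohomologically, now for the q-dependent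
   form); ★★ `norm_moment_sub_axial_le` (`‖ω_c(q+v,κ) − dλ_q(q+v,κ)‖ ≤ |v|₁ · 2δ · Σ_m|c_m|`); ★ `norm_firstMoment_sub_axial_le` (the flux,
   `c_m = L(L−1)∕2`, `|v|₁ ≤ R`: `≤ R·d·L(L−1)·δ`, i.e. `≤ d²L³δ` across a block, `R = dL`);
 * §5 ★★ `norm_corner_sub_stencil_sub_axial_le`: with part 7, on unit-step `δ`-Lipschitz flux near `q`,
   `‖(X̂ L A x κ − [offset-s exponent](x,κ)) − (λ_q(x+e_κ) − λ_q(x))‖ ≤ (2dL + |s|₁)·L·(2(dL+|s|₁)+L)·δ + |x − q|₁·2δ·L|s|₁` for the potential `λ_q` of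
   `ω_{Ls}` — corner (42) minus the offset (centred: `L = 2M+1`, `s = M·𝟙`) stencil IS A PURE GAUGE up to `O((d²L³ + dL²|s|₁ + |s|₁²L)δ)`.
   This is the FINE-lattice reading (`dλ_q` across the unit bond at the coarse bond's base point `x`).  §2–§4 are lattice-agnostic: the COARSE-lattice
   reading — `ω` sampled on the `L`-lattice `q + Lℤᵈ` is a COARSE gradient `Λ(ζ+e_κ) − Λ(ζ)` up to `|ζ|₁·2Lδ·Σ|c|` (the flux moves by `≤ Lδ` per coarse
   step), i.e. the reading under which the corner-block average is a coarse GAUGE TRANSFORM of the offset-block average — and the non-abelian exponents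
   (parts 3∕5's `O(a²)` remainder) are part 9, over this file's §2–§4 by name.

READING FOR N16 (honest).  With parts 1–7 the first-order anatomy of the located pin p584628 is COMPLETE at the linearised∕abelian level modulo part 9's
coarse sampling: (42) ↔ (0.4) = [axis-permutation symmetrisation: `O(d²L³δ)`, zero at constant curvature] + [block centring ∕ reflections: a pure gauge +
`O(d²L³δ)`]; gauge-invariant readings never see the second bracket.  Nothing here is about minimisers.

HONEST FRAMING.  [folklore] finite-sum bookkeeping over `B7Prop1Explicit` (`asum_append`, `asum_plaqWord`, `asum_seg_succ`, `asum_seg_neg`, `disp_*`, `l1_add_le`),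
`B7Prop9General` (`treeWord_split`, `hiPart`, `loPart`), `BlockAverageLoopFlux.asum_loop_eq`, part 6 `asum_loop_const_flux`, part 7 `norm_loop_sub_le` ∕
`norm_corner_sub_stencil_sub_le` BY NAME; 0 `def`, 0 `sorry`; no printed sentence is a hypothesis; nothing of [Balaban1985Averaging] ∕ [Balaban1987RG1] asserted
beyond what the tree proves; no minimiser; `stub_h7` ∕ the K3⁷ stubs NOT touched; N16 ∕ NE3 NOT discharged; count-neutral (typed 28∕28 · discharged 5∕27 work-bound, A 5∕28 — unmoved).
One finite four-torus programme at fixed `ε` — the Yang–Mills mass gap (Clay) is NOT proved by any of this; R4 closes the conditional finite-𝕋⁴ rung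
`BalabanLadder.UV` only; nothing continuum ∕ ℝ⁴ ∕ OS.
-/

set_option autoImplicit false

open scoped BigOperators
open NormedSpace Finset

namespace Summit.QuantumFields.YangMills.BalabanUVNodes.N16Eq42FirstMomentGauge

open Literature.MathematicalPhysics.QuantumFieldTheory.Balaban1983to89
open B7Prop1Explicit
open B7Prop9General (hiPart loPart treeWord_split)
open Summit.QuantumFields.BalabanUV.T4Continuum.BlockAverageLoopFlux (asum_loop_eq)
open Summit.QuantumFields.YangMills.BalabanUVNodes.N16Eq42StencilFirstMoment (asum_loop_const_flux)
open Summit.QuantumFields.YangMills.BalabanUVNodes.N16Eq42StencilLipschitz (norm_loop_sub_le norm_corner_sub_stencil_sub_le)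

noncomputable section

variable {d : ℕ}
variable {𝔸 : Type*} [NormedRing 𝔸]

/-! ## §1 The axial potential along the tree contour: three pieces, and the defect as a unit-bond loop -/

/-- `A` along `seg κ (n+1)` is `A` along `seg κ n` plus the next bond variable, for EVERY integer `n` (the tree's `asum_seg_succ` is the case `n ≥ 0`;
the additive twin of `hol_seg_succ`). [folklore] -/
theorem asum_seg_succ_int (A : Site d → Fin d → 𝔸) (p : Site d) (κ : Fin d) (n : ℤ) :
    asum A p (seg κ (n + 1)) = asum A p (seg κ n) + A (p + n • e κ) κ := by
  rcases Int.eq_nat_or_neg n with ⟨m, rfl | rfl⟩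
  · rw [show (m : ℤ) + 1 = ((m + 1 : ℕ) : ℤ) by push_cast; rfl]
    exact asum_seg_succ A p κ m
  · cases m with
    | zero => simpa using asum_seg_succ A p κ 0
    | succ m =>
      rw [show -((m + 1 : ℕ) : ℤ) + 1 = -(m : ℤ) by push_cast; ring, asum_seg_neg, asum_seg_neg, seg_natCast κ (m + 1),
        List.replicate_succ, asum_cons, stepA_true, Letter.vec_true, ← seg_natCast,
        show p - ((m + 1 : ℕ) : ℤ) • e κ + e κ = p - (m : ℤ) • e κ by rw [Nat.cast_succ, add_smul, one_smul]; abel,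
        show p + -((m + 1 : ℕ) : ℤ) • e κ = p - ((m + 1 : ℕ) : ℤ) • e κ by rw [neg_smul, sub_eq_add_neg]]
      abel

/-- `v = hiPart κ v + v_κ e_κ + loPart κ v` (the decomposition behind `B7Prop9General.treeWord_split`; its lemma there is private). [folklore] -/
theorem parts_sum_eq (κ : Fin d) (v : Site d) : hiPart κ v + v κ • e κ + loPart κ v = v := by
  funext ι
  rcases lt_trichotomy κ ι with h | rfl | h
  · simp [hiPart, loPart, e_apply, h, ne_of_gt h, lt_asymm h]
  · simp [hiPart, loPart, e_apply]
  · simp [hiPart, loPart, e_apply, h, ne_of_lt h, lt_asymm h]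

/-- The high part does not see a step in the direction `κ`. [folklore] -/
theorem hiPart_add_e (κ : Fin d) (v : Site d) : hiPart κ (v + e κ) = hiPart κ v := by
  funext ι
  by_cases h : κ < ι
  · simp [hiPart, h, e_apply, ne_of_gt h]
  · simp [hiPart, h]

/-- The low part does not see a step in the direction `κ`. [folklore] -/
theorem loPart_add_e (κ : Fin d) (v : Site d) : loPart κ (v + e κ) = loPart κ v := by
  funext ι
  by_cases h : ι < κ
  · simp [loPart, h, e_apply, ne_of_lt h]
  · simp [loPart, h]

/-- `|loPart κ v|₁ ≤ |v|₁`. [folklore] -/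
theorem l1_loPart_le (κ : Fin d) (v : Site d) : l1 (loPart κ v) ≤ l1 v := by
  unfold l1
  exact Finset.sum_le_sum fun ι _ => by simp only [loPart]; split_ifs <;> simp

/-- `|v − loPart κ v|₁ ≤ |v|₁` (the high part together with the `κ`-component). [folklore] -/
theorem l1_sub_loPart_le (κ : Fin d) (v : Site d) : l1 (v - loPart κ v) ≤ l1 v := by
  unfold l1
  exact Finset.sum_le_sum fun ι _ => by simp only [Pi.sub_apply, loPart]; split_ifs <;> simp

/-- **THE TREE POTENTIAL IN THREE PIECES**: `A(Γ_{q,q+v}) = A(Γ(hiPart)) + A([κ-segment of v_κ steps]) + A(Γ(loPart) from q + hiPart + v_κe_κ)`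
(`B7Prop9General.treeWord_split` read through `asum_append`). [folklore] -/
theorem asum_treeWord_three (A : Site d → Fin d → 𝔸) (q v : Site d) (κ : Fin d) :
    asum A q (treeWord v) = asum A q (treeWord (hiPart κ v)) + asum A (q + hiPart κ v) (seg κ (v κ))
      + asum A (q + hiPart κ v + v κ • e κ) (treeWord (loPart κ v)) := by
  rw [treeWord_split κ v]
  simp only [asum_append, disp_append, disp_treeWord, disp_seg, add_assoc]

/-- **THE AXIAL POTENTIAL ACROSS ONE BOND.**  For the tree potential `λ_q(x) = A(Γ_{q,x})` of a 1-form `θ`: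
`λ_q(q+v+e_κ) − λ_q(q+v) = θ(p′, κ) + [θ(Γ(loPart) from p′+e_κ) − θ(Γ(loPart) from p′)]`, `p′ = q + hiPart κ v + v_κe_κ` — the two contours share the
high part, the second has one more `κ`-step, and the low parts are translates by `e_κ`. [folklore] -/
theorem axial_diff_eq (θ : Site d → Fin d → 𝔸) (q v : Site d) (κ : Fin d) :
    asum θ q (treeWord (v + e κ)) - asum θ q (treeWord v)
      = θ (q + hiPart κ v + v κ • e κ) κ
        + (asum θ (q + hiPart κ v + v κ • e κ + e κ) (treeWord (loPart κ v))
            - asum θ (q + hiPart κ v + v κ • e κ) (treeWord (loPart κ v))) := by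
  rw [asum_treeWord_three θ q (v + e κ) κ, asum_treeWord_three θ q v κ, hiPart_add_e, loPart_add_e,
    show (v + e κ) κ = v κ + 1 by simp [e_apply], asum_seg_succ_int, add_smul, one_smul, ← add_assoc]
  abel

/-- **★ THE AXIAL-GAUGE DEFECT IS A UNIT-BOND (42)-LOOP.**  `θ(q+v, κ) − (λ_q(q+v+e_κ) − λ_q(q+v))` equals the circulation of `θ` around the loop
`Γ_{c,p′+w} ∪ (−Γ_c)` of the tree's (42)-contour calculus for the UNIT bond `c = ⟨p′, p′+e_κ⟩` (`L = 1`), `p′ = q + hiPart κ v + v_κe_κ`, offset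
`w = loPart κ v` (tree `BlockAverageLoopFlux.asum_loop_eq`). [folklore] -/
theorem sub_axial_eq_loop (θ : Site d → Fin d → 𝔸) (q v : Site d) (κ : Fin d) :
    θ (q + v) κ - (asum θ q (treeWord (v + e κ)) - asum θ q (treeWord v))
      = asum θ (q + hiPart κ v + v κ • e κ) (gammaWord 1 κ (loPart κ v) ++ seg κ (-((1 : ℕ) : ℤ))) := by
  rw [axial_diff_eq, asum_loop_eq]
  have hx : q + v = q + hiPart κ v + v κ • e κ + loPart κ v := by
    conv_lhs => rw [← parts_sum_eq κ v]
    simp only [add_assoc]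
  have h1 : ∀ x : Site d, asum θ x (seg κ ((1 : ℕ) : ℤ)) = θ x κ := fun x => by
    rw [show seg κ ((1 : ℕ) : ℤ) = [((κ, true) : Letter d)] from rfl, asum_cons, asum_nil, stepA_true, add_zero]
  rw [hx, h1, h1, Nat.cast_one, one_smul]
  abel

/-! ## §2 The lattice Poincaré lemma in the axial gauge -/

/-- **★ CLOSED ⇒ EXACT (ℤᵈ has no first cohomology), with the explicit axial potential.**  If every plaquette circulation of `θ` in the planes
`(m, κ)` vanishes, then on every `κ`-bond `θ(q+v, κ) = λ_q(q+v+e_κ) − λ_q(q+v)`, `λ_q(x) = asum θ q (treeWord (x − q))` (part 6's signed constant-flux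
circulation `asum_loop_const_flux` at `L = 1`, `f = 0`). [folklore] -/
theorem eq_axial_of_closed (θ : Site d → Fin d → 𝔸) (κ : Fin d)
    (hclosed : ∀ (y : Site d) (m : Fin d), asum θ y (plaqWord m κ) = 0) (q v : Site d) :
    θ (q + v) κ = asum θ q (treeWord (v + e κ)) - asum θ q (treeWord v) := by
  have h := sub_axial_eq_loop θ q v κ
  rw [asum_loop_const_flux 1 θ _ κ (fun _ => (0 : 𝔸)) (fun y m => hclosed y m) (loPart κ v)] at h
  simp only [smul_zero, Finset.sum_const_zero] at h
  exact sub_eq_zero.mp h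

/-- **★★ THE LATTICE POINCARÉ LEMMA WITH ESTIMATE (axial gauge).**  If every plaquette circulation of `θ` in the planes `(m, κ)` at base points within
`|·|₁`-distance `3|v|₁ + 1` of `q` has norm `≤ η`, then `‖θ(q+v, κ) − (λ_q(q+v+e_κ) − λ_q(q+v))‖ ≤ |v|₁ · η` (part 7's `norm_loop_sub_le` at `L = 1`,
`f = 0`: the defect loop encloses `|loPart κ v|₁ ≤ |v|₁` plaquettes). [folklore] -/
theorem norm_sub_axial_le (θ : Site d → Fin d → 𝔸) (q v : Site d) (κ : Fin d) {η : ℝ}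
    (hcurl : ∀ (m : Fin d) (y : Site d), l1 (y - q) ≤ 3 * l1 v + 1 → ‖asum θ y (plaqWord m κ)‖ ≤ η) :
    ‖θ (q + v) κ - (asum θ q (treeWord (v + e κ)) - asum θ q (treeWord v))‖ ≤ l1 v * η := by
  rw [sub_axial_eq_loop]
  have hpq : q + hiPart κ v + v κ • e κ - q = v - loPart κ v := by
    rw [← eq_sub_of_add_eq (parts_sum_eq κ v)]; abel
  have hη : 0 ≤ η := le_trans (norm_nonneg _) (hcurl κ q (by rw [sub_self]; unfold l1; simp))
  have h := norm_loop_sub_le 1 θ (q + hiPart κ v + v κ • e κ) κ (fun _ => (0 : 𝔸)) (loPart κ v) (Δ := η)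
    (fun m x hx => by
      rw [sub_zero]
      refine hcurl m x ?_
      have h1 := l1_add_le (x - (q + hiPart κ v + v κ • e κ)) (q + hiPart κ v + v κ • e κ - q)
      rw [show x - (q + hiPart κ v + v κ • e κ) + (q + hiPart κ v + v κ • e κ - q) = x - q by abel, hpq] at h1
      have h2 := l1_sub_loPart_le κ v
      have h3 := l1_loPart_le κ v
      omega)
  simp only [smul_zero, Finset.sum_const_zero, sub_zero, Nat.cast_one, mul_one] at h
  refine h.trans ?_
  have : (l1 (loPart κ v) : ℝ) ≤ l1 v := by exact_mod_cast l1_loPart_le κ v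
  exact mul_le_mul_of_nonneg_right this hη

/-- **UNIT STEPS INTEGRATE ALONG THE TREE CONTOUR**: if a site function moves by `≤ δ` under every unit step at base points within `|·|₁`-distance `R`
of `q`, then along any lattice word `W` from `x` with `|x − q|₁ + |W| ≤ R`, `‖F(x + disp W) − F(x)‖ ≤ δ·|W|`. [folklore] -/
theorem norm_sub_le_of_unit_steps (F : Site d → 𝔸) (q : Site d) (R : ℕ) {δ : ℝ}
    (hLip : ∀ (y : Site d) (μ : Fin d), l1 (y - q) ≤ R → ‖F (y + e μ) - F y‖ ≤ δ) :
    ∀ (x : Site d) (W : List (Letter d)), l1 (x - q) + W.length ≤ R → ‖F (x + disp W) - F x‖ ≤ δ * W.length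
  | x, [], _ => by simp
  | x, l :: W, hx => by
    rw [List.length_cons] at hx
    have hl : l1 (x + l.vec - q) ≤ l1 (x - q) + 1 := by
      have := l1_add_le (x - q) l.vec
      rw [l1_vec, show x - q + l.vec = x + l.vec - q by abel] at this
      exact this
    have hrec := norm_sub_le_of_unit_steps F q R hLip (x + l.vec) W (by omega)
    have hstep : ‖F (x + l.vec) - F x‖ ≤ δ := by
      obtain ⟨μ, b⟩ := l
      cases b
      · -- backward letter: `vec = −e_μ`; use the unit step at `x − e_μ`
        have hl' : l1 (x - e μ - q) ≤ R := by
          rw [Letter.vec_false, ← sub_eq_add_neg] at hl; omega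
        have h := hLip (x - e μ) μ hl'
        rw [show x - e μ + e μ = x by abel, ← norm_neg, neg_sub] at h
        simpa [Letter.vec, sub_eq_add_neg] using h
      · simpa [Letter.vec] using hLip x μ (by omega)
    rw [disp_cons, List.length_cons, Nat.cast_succ, mul_add, mul_one,
      show x + (l.vec + disp W) = x + l.vec + disp W by abel]
    calc ‖F (x + l.vec + disp W) - F x‖
        = ‖(F (x + l.vec + disp W) - F (x + l.vec)) + (F (x + l.vec) - F x)‖ := by rw [sub_add_sub_cancel]
      _ ≤ ‖F (x + l.vec + disp W) - F (x + l.vec)‖ + ‖F (x + l.vec) - F x‖ := norm_add_le _ _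
      _ ≤ δ * W.length + δ := add_le_add hrec hstep

/-- Along the tree contour: `‖F(x + w) − F(x)‖ ≤ δ·|w|₁` when `|x − q|₁ + |w|₁ ≤ R`. [folklore] -/
theorem norm_sub_le_of_unit_steps_tree (F : Site d → 𝔸) (q : Site d) (R : ℕ) {δ : ℝ}
    (hLip : ∀ (y : Site d) (μ : Fin d), l1 (y - q) ≤ R → ‖F (y + e μ) - F y‖ ≤ δ) (x w : Site d)
    (hx : l1 (x - q) + l1 w ≤ R) : ‖F (x + w) - F x‖ ≤ δ * l1 w := by
  have h := norm_sub_le_of_unit_steps F q R hLip x (treeWord w) (by rw [length_treeWord]; exact hx)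
  rwa [disp_treeWord, length_treeWord] at h

/-! ## §3 The curl of the first-moment 1-form `ω_c(y,κ) = Σ_m c_m • F_y(m κ)` of a plane-indexed site function `F` -/

section Moment

variable [NormedAlgebra ℂ 𝔸]

/-- **THE CURL OF THE MOMENT FORM IS A FIRST DIFFERENCE OF `F`**: for any plane-indexed family of site functions `F` (the case of interest:
the flux `F_y(m κ) = A(∂p)_y(plaqWord m κ)`, §5; its coarse samples, part 9),
`ω_c(∂p)_y(μ ν) = Σ_m c_m • [(F_{y+e_μ}(m ν) − F_y(m ν)) − (F_{y+e_ν}(m μ) − F_y(m μ))]` (`asum_plaqWord`). [folklore] -/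
theorem curl_moment_eq (F : Site d → Fin d → Fin d → 𝔸) (c : Fin d → ℝ) (y : Site d) (μ ν : Fin d) :
    asum (fun z κ' => ∑ m : Fin d, c m • F z m κ') y (plaqWord μ ν)
      = ∑ m : Fin d, c m • ((F (y + e μ) m ν - F y m ν) - (F (y + e ν) m μ - F y m μ)) := by
  rw [asum_plaqWord]
  simp only [smul_sub, Finset.sum_sub_distrib]
  abel

/-- At CONSTANT data (`F_y(m κ) = f m κ` for all base points — constant curvature) the moment form is CLOSED. [folklore] -/
theorem curl_moment_of_const (F : Site d → Fin d → Fin d → 𝔸) (c : Fin d → ℝ) (f : Fin d → Fin d → 𝔸)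
    (hf : ∀ (y : Site d) (m κ : Fin d), F y m κ = f m κ) (y : Site d) (μ ν : Fin d) :
    asum (fun z κ' => ∑ m : Fin d, c m • F z m κ') y (plaqWord μ ν) = 0 := by
  rw [curl_moment_eq]
  simp [hf]

/-- If `F` moves by `≤ δ` under the unit steps `e_μ` (planes `(m,ν)`) and `e_ν` (planes `(m,μ)`) at `y`: `‖ω_c(∂p)_y(μ ν)‖ ≤ 2δ·Σ_m |c_m|`. [folklore] -/
theorem norm_curl_moment_le (F : Site d → Fin d → Fin d → 𝔸) (c : Fin d → ℝ) (y : Site d) (μ ν : Fin d) {δ : ℝ}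
    (hν : ∀ m : Fin d, ‖F (y + e μ) m ν - F y m ν‖ ≤ δ) (hμ : ∀ m : Fin d, ‖F (y + e ν) m μ - F y m μ‖ ≤ δ) :
    ‖asum (fun z κ' => ∑ m : Fin d, c m • F z m κ') y (plaqWord μ ν)‖ ≤ 2 * δ * ∑ m : Fin d, |c m| := by
  rw [curl_moment_eq, Finset.mul_sum]
  refine (norm_sum_le _ _).trans (Finset.sum_le_sum fun m _ => ?_)
  rw [norm_smul, Real.norm_eq_abs, mul_comm (2 * δ) |c m|]
  refine mul_le_mul_of_nonneg_left ((norm_sub_le _ _).trans ?_) (abs_nonneg _)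
  linarith [hν m, hμ m]

/-! ## §4 The first-moment 1-form is a gauge: exactly at constant curvature, up to `|x − q|₁·2δ·Σ|c|` on Lipschitz data -/

/-- **★ CONSTANT CURVATURE: `ω_c = dλ_q` EXACTLY** (the q-dependent moment form of constant data is the gradient of its own tree potential; cf.
part 6's `stencil_shift_is_gradient`, the linear potential). [folklore] -/
theorem moment_eq_axial_of_const (F : Site d → Fin d → Fin d → 𝔸) (c : Fin d → ℝ) (f : Fin d → Fin d → 𝔸)
    (hf : ∀ (y : Site d) (m κ : Fin d), F y m κ = f m κ) (q v : Site d) (κ : Fin d) :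
    (∑ m : Fin d, c m • F (q + v) m κ)
      = asum (fun z κ' => ∑ m : Fin d, c m • F z m κ') q (treeWord (v + e κ))
        - asum (fun z κ' => ∑ m : Fin d, c m • F z m κ') q (treeWord v) :=
  eq_axial_of_closed (fun z κ' => ∑ m : Fin d, c m • F z m κ') κ (fun y m => curl_moment_of_const F c f hf y m κ) q v

/-- **★★ LIPSCHITZ DATA: `ω_c = dλ_q + O(|v|₁·δ·Σ|c|)`.**  If `F` moves by `≤ δ` under every unit step, in every plane, at base points within
`|·|₁`-distance `3|v|₁ + 1` of `q`, then `‖ω_c(q+v, κ) − (λ_q(q+v+e_κ) − λ_q(q+v))‖ ≤ |v|₁ · 2δ · Σ_m|c_m|` — the q-DEPENDENT first-moment 1-form is a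
pure gauge up to that error. [folklore] -/
theorem norm_moment_sub_axial_le (F : Site d → Fin d → Fin d → 𝔸) (c : Fin d → ℝ) (q v : Site d) (κ : Fin d) {δ : ℝ}
    (hLip : ∀ (y : Site d) (m μ ν : Fin d), l1 (y - q) ≤ 3 * l1 v + 1 → ‖F (y + e μ) m ν - F y m ν‖ ≤ δ) :
    ‖(∑ m : Fin d, c m • F (q + v) m κ)
        - (asum (fun z κ' => ∑ m : Fin d, c m • F z m κ') q (treeWord (v + e κ))
            - asum (fun z κ' => ∑ m : Fin d, c m • F z m κ') q (treeWord v))‖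
      ≤ l1 v * (2 * δ * ∑ m : Fin d, |c m|) :=
  norm_sub_axial_le (fun z κ' => ∑ m : Fin d, c m • F z m κ') q v κ
    (fun m y hy => norm_curl_moment_le F c y m κ (fun m' => hLip y m' m κ hy) (fun m' => hLip y m' κ m hy))

/-- **★ THE FIRST-MOMENT FORM OF THE PIN (corner (42) vs centred (0.4): `c_m = L(L−1)∕2`) ACROSS A BLOCK**, for the FLUX `F_y(m κ) = A(∂p)_y(m κ)`:
for `|v|₁ ≤ R`, `‖(L(L−1)∕2)•Σ_m F_{mκ}(q+v) − dλ_q(q+v, κ)‖ ≤ R·d·L(L−1)·δ` — with `R = dL` (any bond of the block at `q`): `≤ d²L²(L−1)δ ≤ d²L³δ`,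
the located `O(d²L³δ)`. [folklore] -/
theorem norm_firstMoment_sub_axial_le (L : ℕ) (hL : 1 ≤ L) (A : Site d → Fin d → 𝔸) (q v : Site d) (κ : Fin d) {δ : ℝ} (hδ : 0 ≤ δ)
    {R : ℕ} (hv : l1 v ≤ R)
    (hLip : ∀ (y : Site d) (m μ ν : Fin d), l1 (y - q) ≤ 3 * R + 1 →
      ‖asum A (y + e μ) (plaqWord m ν) - asum A y (plaqWord m ν)‖ ≤ δ) :
    ‖(∑ m : Fin d, ((L : ℝ) * (((L : ℝ) - 1) / 2)) • asum A (q + v) (plaqWord m κ))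
        - (asum (fun z κ' => ∑ m : Fin d, ((L : ℝ) * (((L : ℝ) - 1) / 2)) • asum A z (plaqWord m κ')) q (treeWord (v + e κ))
            - asum (fun z κ' => ∑ m : Fin d, ((L : ℝ) * (((L : ℝ) - 1) / 2)) • asum A z (plaqWord m κ')) q (treeWord v))‖
      ≤ R * d * ((L : ℝ) * ((L : ℝ) - 1)) * δ := by
  have h := norm_moment_sub_axial_le (fun y m κ' => asum A y (plaqWord m κ')) (fun _ => (L : ℝ) * (((L : ℝ) - 1) / 2)) q v κ
    (δ := δ) (fun y m μ ν hy => hLip y m μ ν (by omega))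
  refine h.trans ?_
  have hL1 : (0 : ℝ) ≤ (L : ℝ) * (((L : ℝ) - 1) / 2) := by
    have : (1 : ℝ) ≤ L := by exact_mod_cast hL
    nlinarith
  rw [Finset.sum_const, Finset.card_univ, Fintype.card_fin, nsmul_eq_mul, abs_of_nonneg hL1]
  have hvR : (l1 v : ℝ) ≤ R := by exact_mod_cast hv
  have h2 : (0 : ℝ) ≤ 2 * δ * (d * ((L : ℝ) * (((L : ℝ) - 1) / 2))) := by positivity
  calc (l1 v : ℝ) * (2 * δ * (d * ((L : ℝ) * (((L : ℝ) - 1) / 2))))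
      ≤ R * (2 * δ * (d * ((L : ℝ) * (((L : ℝ) - 1) / 2)))) := mul_le_mul_of_nonneg_right hvR h2
    _ = R * d * ((L : ℝ) * ((L : ℝ) - 1)) * δ := by ring

/-! ## §5 With part 7: corner (42) minus the offset stencil is the pure gauge `dλ_q` up to `O(L³δ)` -/

/-- **★★ THE BLOCK-CENTRING PART OF THE PIN IS GAUGE + `O(L³δ)` (the last located sentence, typed).**  Let the flux of `A` move by `≤ δ` under every
unit step at base points within `|·|₁`-distance `R` of `q`, `R ≥ 3|v|₁ + 1` and `R ≥ |v|₁ + 2(dL + |s|₁) + L`.  Then at the bond `(x, κ)`, `x = q + v`, the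
corner-block exponent (42) minus the offset-`s` stencil exponent (centred block of (0.4): `L = 2M+1`, `s = M·𝟙`) is the pure gauge `λ_q(x+e_κ) − λ_q(x)`
— `λ_q` the tree potential of the first-moment form `ω_{Ls}(y,κ) = Σ_m (L s_m) • F_{mκ}(y)` — up to
`(2dL + |s|₁)·L·((2(dL+|s|₁)+L)·δ) + |v|₁·(2δ·L·|s|₁)` (part 7 `norm_corner_sub_stencil_sub_le` with `Δ = (2(dL+|s|₁)+L)δ` from the unit steps, plus §4).
[folklore] -/
theorem norm_corner_sub_stencil_sub_axial_le (L : ℕ) (hL : 1 ≤ L) (A : Site d → Fin d → 𝔸) (q v : Site d) (κ : Fin d) (s : Site d)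
    {δ : ℝ} (hδ : 0 ≤ δ) {R : ℕ} (hR : 3 * l1 v + 1 ≤ R) (hR' : l1 v + (2 * (d * L + l1 s) + L) ≤ R)
    (hLip : ∀ (y : Site d) (m μ ν : Fin d), l1 (y - q) ≤ R →
      ‖asum A (y + e μ) (plaqWord m ν) - asum A y (plaqWord m ν)‖ ≤ δ) :
    ‖(Xhat L A (q + v) κ
          - ∑ r : Fin d → Fin L, (((L : ℝ) ^ d)⁻¹) • asum A (q + v) (gammaWord L κ (boxVec L r - s) ++ seg κ (-(L : ℤ))))
        - (asum (fun z κ' => ∑ m : Fin d, ((L : ℝ) * (s m : ℝ)) • asum A z (plaqWord m κ')) q (treeWord (v + e κ))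
            - asum (fun z κ' => ∑ m : Fin d, ((L : ℝ) * (s m : ℝ)) • asum A z (plaqWord m κ')) q (treeWord v))‖
      ≤ (2 * (d * L) + l1 s) * L * ((2 * (d * L + l1 s) + L) * δ) + l1 v * (2 * δ * ((L : ℝ) * l1 s)) := by
  -- part 7: corner − stencil = Σ_m (L s_m) • F_{mκ}(x) + O(…), with Δ := (2(dL+|s|₁)+L)·δ from the unit-step Lipschitz bound
  have hΔ : 0 ≤ (2 * (d * L + l1 s) + L : ℝ) * δ := by positivity
  have h7 := norm_corner_sub_stencil_sub_le L hL A (q + v) κ (fun m => asum A (q + v) (plaqWord m κ)) s hΔ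
    (fun m x hx => by
      have h := norm_sub_le_of_unit_steps_tree (fun y => asum A y (plaqWord m κ)) q R (δ := δ)
        (fun y μ hy => hLip y m μ κ hy) (q + v) (x - (q + v))
        (by have : l1 (q + v - q) = l1 v := by rw [add_sub_cancel_left]
            omega)
      rw [show q + v + (x - (q + v)) = x by abel] at h
      refine h.trans ?_
      rw [mul_comm]
      exact mul_le_mul_of_nonneg_right (by exact_mod_cast hx) hδ)
  -- §4: Σ_m (L s_m) • F_{mκ}(x) = dλ_q + O(|v|₁ δ L|s|₁)
  have h4 := norm_moment_sub_axial_le (fun y m κ' => asum A y (plaqWord m κ')) (fun m => (L : ℝ) * (s m : ℝ)) q v κ (δ := δ)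
    (fun y m μ ν hy => hLip y m μ ν (by omega))
  have hsum : ∑ m : Fin d, |(L : ℝ) * (s m : ℝ)| = (L : ℝ) * l1 s := by
    unfold l1
    push_cast
    rw [Finset.mul_sum]
    refine Finset.sum_congr rfl fun m _ => ?_
    rw [abs_mul, Nat.abs_cast, Nat.cast_natAbs, Int.cast_abs]
  rw [hsum] at h4
  calc _ = ‖((Xhat L A (q + v) κ
              - ∑ r : Fin d → Fin L, (((L : ℝ) ^ d)⁻¹) • asum A (q + v) (gammaWord L κ (boxVec L r - s) ++ seg κ (-(L : ℤ))))
            - ∑ m : Fin d, ((L : ℝ) * (s m : ℝ)) • asum A (q + v) (plaqWord m κ))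
          + ((∑ m : Fin d, ((L : ℝ) * (s m : ℝ)) • asum A (q + v) (plaqWord m κ))
            - (asum (fun z κ' => ∑ m : Fin d, ((L : ℝ) * (s m : ℝ)) • asum A z (plaqWord m κ')) q (treeWord (v + e κ))
              - asum (fun z κ' => ∑ m : Fin d, ((L : ℝ) * (s m : ℝ)) • asum A z (plaqWord m κ')) q (treeWord v)))‖ := by
          rw [sub_add_sub_cancel]
    _ ≤ _ := norm_add_le _ _
    _ ≤ _ := add_le_add h7 h4

end Moment

end

end Summit.QuantumFields.YangMills.BalabanUVNodes.N16Eq42FirstMomentGauge
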